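import Mathlib.Analysis.InnerProductSpace.Spectrum
import Literature.Geometry.Lorentzian.RiemannianMeasureComparison
import Literature.Geometry.Lorentzian.InverseMeanCurvatureFlowConstancy
import Literature.Geometry.Lorentzian.InverseMeanCurvatureFlowMinimizers
import HarnessLib

/-!
# Inverse mean curvature flow I — proofs: dependence of the weak formulation on the metric
# (locality, and monotonicity under enlarging the metric; proof of Thm. 3.1, step 2)

Sorry-free lemmas for step 2 of the proof of Huisken–Ilmanen's Weak Existence Theorem 3.1
(J. Differential Geom. 59 (2001), §3, p. 36 of the printed paper): the metric `g` is modified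
to a complete metric `g_L` on `U_L ⊃ F̄_L` with "`g_L = g` on `F_L`", a solution `u_L` of (††) is
produced *for `g_L`*, and it is then used as a solution *for `g`* on `F_L` ("Passing `L → ∞` …
the Compactness Theorem 2.1 yields a solution `u` defined everywhere on `M`"); likewise
"`min(v, L)` is a weak subsolution in `U_L` with respect to `g`. Since `g = g_L` where `v < L` …".
Both steps use, tacitly, that the level-set weak formulation (1.5) of
`InverseMeanCurvatureFlow.lean` on an open set `Ω` *only depends on the metric on `Ω`*. This file
proves it for two smooth Riemannian metrics `h, h'` on the `3`-manifold `X`: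

* `IsLocLipschitzOn.of_metric`, `isLocLipschitzOn_iff_of_metric` — **local Lipschitz continuity
  for the Riemannian distance does not depend on the metric** (no agreement needed: any two
  continuous Riemannian metrics are locally bi-Lipschitz to the same charts,
  `exists_nhds_riemannianEDist_le_and_edist_le`), hence neither do competitors
  (`IsCompetitor.of_metric`);
* `sharp_congr_of_inner_eq`, `innerDual_congr_of_inner_eq`, `gradNorm_congr_of_inner_eq` —
  at a point where `h_x = h'_x`, index raising, the inverse metric and the slope `|∇u|(x)` agree;
* `sharp_comp_toBilinForm_eq_id_of_inner_eq`, `riemannianMeasure_restrict_congr_of_inner_eq` —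
  where the metrics agree the density `√det(h'⁻¹ h)` of `dμ_h = √det(h'⁻¹h) dμ_{h'}`
  (`riemannianMeasure_eq_withDensity_sqrt_det_endo`, `RiemannianMeasureComparison.lean`) is `1`,
  so the Riemannian measures agree on every measurable set on which the metrics agree;
* `imcfEnergy_congr_of_inner_eq` — hence `J_u^K(v)` computed with `h` and with `h'` agree for
  `K ⊆ Ω` when `h = h'` on `Ω`;
* `IsWeakSolution.of_metric`, `IsWeakSubsolution.of_metric`, `IsWeakSupersolution.of_metric` and
  the `iff` forms — **weak (sub/super)solutions of (∗∗) on `Ω` for `h` are exactly those for `h'`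
  when `h = h'` on `Ω`.**

and the companion *inequality* for `h ≤ h'` ("`g_L ≥ g` … `min(v, L)` remains a weak subsolution
when considered with respect to the metric `g_L`"):

* `inner_mul_det_ge_inner_self` — linear algebra: for a symmetric operator `T` on a
  finite-dimensional real inner product space with `⟪v, v⟫ ≤ ⟪T v, v⟫` (all eigenvalues `≥ 1`),
  `⟪T c, T c⟫ ≤ ⟪T c, c⟫ · det T` (diagonalise, Mathlib's `LinearMap.IsSymmetric.eigenvectorBasis`
  and `det_eq_prod_eigenvalues`: `∑ λᵢ² cᵢ² ≤ (∑ λᵢ cᵢ²) ∏ λⱼ` as `λᵢ ≤ ∏ λⱼ`);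
* `gradNorm_le_gradNorm_mul_sqrt_det` — **the slope–density inequality**
  `|∇u|_h ≤ |∇u|_{h'} · √det(♯_h ∘ ♭_{h'})` when `h ≤ h'` (the `√det` being the density
  `dμ_{h'}/dμ_h`): the infinitesimal form of "areas of level sets increase with the metric";
* `IsWeakSubsolution.of_metric_le` — **the transfer theorem**: if `h ≤ h'` on `X`, `h = h'` on an
  open set `W`, `u` is a weak subsolution of (∗∗) on the open set `Ω` for `h`, and `|∇u|_h = 0`
  `μ_h`-a.e. on `Ω ∖ W`, then `u` is a weak subsolution on `Ω` for `h'` (for `u = min(v, L)`,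
  `W = {v < L}`, the last hypothesis is `IsLocLipschitzOn.ae_gradNorm_eq_zero_of_eq_const`):
  with `dμ_{h'} = ρ dμ_h`, `ρ|∇u|_{h'} = |∇u|_h` a.e. on `Ω` while `ρ|∇w|_{h'} ≥ |∇w|_h` for the
  competitor `w`, so `J^{h'}_u(w) − J^{h'}_u(u) ≥ J^h_u(w) − J^h_u(u) ≥ 0`;
* `IsWeakSubsolution.inf_const_of_metric_le`, `IsWeakSubsolutionIVP.inf_const_of_metric_le` —
  Huisken–Ilmanen's sentence itself: `min(v, L)` is a weak subsolution for `h'` when `v` is one for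
  `h`, `h ≤ h'`, and `h = h'` on `{v < L}` ((1.18), `IsWeakSubsolution.inf_const`, and the above).

Everything is proved; there are no definitions and no named facts.

## References

* G. Huisken, T. Ilmanen, *The inverse mean curvature flow and the Riemannian Penrose
  inequality*, J. Differential Geom. 59 (2001) 353–437: §3, proof of Thm. 3.1, step 2
  ("`g_L = g` on `F_L`"; "`min(v, L)` … remains a weak subsolution … with respect to `g_L`").
* I. Chavel, *Riemannian Geometry: A Modern Introduction*, 2nd ed., CUP 2006, §III.3
  (III.3.5)–(III.3.6) (Riemannian measure in a chart).
-/

noncomputable section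

open Bundle Set Manifold TopologicalSpace Filter MeasureTheory Measure Function
open scoped ContDiff Topology ENNReal NNReal Manifold Real InnerProductSpace

namespace Literature.Geometry.Lorentzian

open PseudoRiemannianMetric

/-! ### Linear algebra: `⟪T c, T c⟫ ≤ ⟪T c, c⟫ det T` for symmetric `T ≥ 1` -/

section LinearAlgebra

variable {V : Type*} [NormedAddCommGroup V] [InnerProductSpace ℝ V] [FiniteDimensional ℝ V]

/-- **For a symmetric operator `T ≥ 1` on a finite-dimensional real inner product space,
`⟪T c, T c⟫ ≤ ⟪T c, c⟫ · det T`.** In an orthonormal eigenbasis with eigenvalues `λᵢ ≥ 1`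
this reads `∑ λᵢ² cᵢ² ≤ (∑ λᵢ cᵢ²) ∏ⱼ λⱼ`, true termwise since `λᵢ ≤ ∏ⱼ λⱼ`. [folklore] -/
theorem inner_mul_det_ge_inner_self {T : V →ₗ[ℝ] V} (hT : T.IsSymmetric)
    (hge : ∀ v : V, ⟪v, v⟫_ℝ ≤ ⟪T v, v⟫_ℝ) (c : V) :
    ⟪T c, T c⟫_ℝ ≤ ⟪T c, c⟫_ℝ * LinearMap.det T := by
  classical
  set n := Module.finrank ℝ V with hn
  set b := hT.eigenvectorBasis hn.symm with hb
  set ev := hT.eigenvalues hn.symm with hev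
  have happly : ∀ i, T (b i) = (ev i : ℝ) • b i := fun i ↦ hT.apply_eigenvectorBasis hn.symm i
  -- eigenvalues are `≥ 1`
  have hev1 : ∀ i, (1 : ℝ) ≤ ev i := by
    intro i
    have h1 := hge (b i)
    rw [happly, real_inner_smul_left, real_inner_self_eq_norm_sq, b.orthonormal.1 i] at h1
    simpa using h1
  have hev0 : ∀ i, (0 : ℝ) ≤ ev i := fun i ↦ zero_le_one.trans (hev1 i)
  -- coordinates
  have hTb : ∀ i, ⟪T c, b i⟫_ℝ = ev i * ⟪c, b i⟫_ℝ := by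
    intro i
    rw [hT c (b i), happly, real_inner_smul_right]
  have h1 : ⟪T c, c⟫_ℝ = ∑ i, ev i * ⟪c, b i⟫_ℝ ^ 2 := by
    rw [← b.sum_inner_mul_inner (T c) c]
    refine Finset.sum_congr rfl fun i _ ↦ ?_
    rw [hTb, real_inner_comm (b i) c]
    ring
  have h2 : ⟪T c, T c⟫_ℝ = ∑ i, ev i ^ 2 * ⟪c, b i⟫_ℝ ^ 2 := by
    rw [← b.sum_inner_mul_inner (T c) (T c)]
    refine Finset.sum_congr rfl fun i _ ↦ ?_
    rw [real_inner_comm (T c) (b i), hTb]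
    ring
  have hdet : LinearMap.det T = ∏ i, ev i := by
    simpa using hT.det_eq_prod_eigenvalues hn.symm
  -- `λᵢ ≤ ∏ⱼ λⱼ`
  have hle : ∀ i, ev i ≤ ∏ j, ev j := by
    intro i
    have : (∏ j, if j = i then ev i else (1 : ℝ)) ≤ ∏ j, ev j :=
      Finset.prod_le_prod (fun j _ ↦ by split_ifs <;> [exact hev0 i; exact zero_le_one])
        (fun j _ ↦ by split_ifs with hj <;> [rw [hj]; exact hev1 j])
    simpa using this
  rw [h1, h2, hdet, Finset.sum_mul]
  refine Finset.sum_le_sum fun i _ ↦ ?_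
  have hc : 0 ≤ ev i * ⟪c, b i⟫_ℝ ^ 2 := mul_nonneg (hev0 i) (sq_nonneg _)
  calc ev i ^ 2 * ⟪c, b i⟫_ℝ ^ 2 = ev i * ⟪c, b i⟫_ℝ ^ 2 * ev i := by ring
    _ ≤ ev i * ⟪c, b i⟫_ℝ ^ 2 * ∏ j, ev j := mul_le_mul_of_nonneg_left (hle i) hc

end LinearAlgebra

variable {X : Type*} [TopologicalSpace X] [ChartedSpace E3 X] [IsManifold (𝓡 3) ∞ X]

/-! ### Pointwise agreement of the metrics -/

section Pointwise

variable (h h' : ContMDiffRiemannianMetric (𝓡 3) ∞ E3 (TangentSpace (𝓡 3) : X → Type _))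

/-- Index raising `♯` at `x` only depends on the metric at `x`. [folklore] -/
theorem sharp_congr_of_inner_eq {x : X} (hx : h.inner x = h'.inner x)
    (α : Module.Dual ℝ (TangentSpace (𝓡 3) x)) :
    (ofRiemannian h).sharp x α = (ofRiemannian h').sharp x α := by
  apply (ofRiemannian h').flat_injective x
  refine LinearMap.ext fun w ↦ ?_
  rw [flat_apply, flat_apply, val_sharp_apply]
  have hval : (ofRiemannian h').val x = (ofRiemannian h).val x := by
    show h'.inner x = h.inner x
    exact hx.symm
  rw [hval, val_sharp_apply]

/-- The inverse metric `h⁻¹(α, β)` at `x` only depends on the metric at `x`. [folklore] -/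
theorem innerDual_congr_of_inner_eq {x : X} (hx : h.inner x = h'.inner x)
    (α β : Module.Dual ℝ (TangentSpace (𝓡 3) x)) :
    (ofRiemannian h).innerDual x α β = (ofRiemannian h').innerDual x α β := by
  simp only [PseudoRiemannianMetric.innerDual, sharp_congr_of_inner_eq h h' hx]

/-- **The slope `|∇u|(x)` only depends on the metric at `x`.** [folklore] -/
theorem gradNorm_congr_of_inner_eq {x : X} (hx : h.inner x = h'.inner x) (u : X → ℝ) :
    gradNorm h u x = gradNorm h' u x := by
  simp only [gradNorm, innerDual_congr_of_inner_eq h h' hx]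

/-- Where the metrics agree, the endomorphism `♯_{h'} ∘ ♭_h` (whose determinant is the density
`dμ_h/dμ_{h'}` squared) is the identity. [folklore] -/
theorem sharp_comp_toBilinForm_eq_id_of_inner_eq {x : X} (hx : h.inner x = h'.inner x) :
    ((ofRiemannian h').sharp x).toLinearMap ∘ₗ (ofRiemannian h).toBilinForm x = LinearMap.id := by
  refine LinearMap.ext fun v ↦ ?_
  have hflat : (ofRiemannian h).toBilinForm x v = (ofRiemannian h').flat x v := by
    refine LinearMap.ext fun w ↦ ?_
    rw [toBilinForm_apply, flat_apply]
    show h.inner x v w = h'.inner x v w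
    rw [hx]
  simp only [LinearMap.coe_comp, LinearEquiv.coe_coe, Function.comp_apply, LinearMap.id_coe,
    id_eq, hflat, sharp_flat]

/-! ### The slope–density inequality `|∇u|_h ≤ |∇u|_{h'} √det(♯_h ∘ ♭_{h'})` for `h ≤ h'` -/

set_option backward.isDefEq.respectTransparency false in
/-- **Slope–density inequality.** If `h ≤ h'` as quadratic forms at `x`, then for every function
`u`, `|∇u|_h(x) ≤ |∇u|_{h'}(x) · √det T_x` with `T_x = ♯_h ∘ ♭_{h'}` the endomorphism expressing
`h'` through `h` (`h'(v, w) = h(T v, w)`), whose `√det` is the density `dμ_{h'}/dμ_h`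
(`riemannianMeasure_eq_withDensity_sqrt_det_endo`). With `c = ♯_{h'} du` one has `T c = ♯_h du`,
`|∇u|²_{h'} = h(Tc, c)`, `|∇u|²_h = h(Tc, Tc)`, and the claim is `inner_mul_det_ge_inner_self`.
This is the pointwise form of "`|∂F|` increases with the metric" behind Huisken–Ilmanen's
"`g_L ≥ g` … `min(v, L)` remains a weak subsolution with respect to `g_L`".
[cite: HuiskenIlmanenIMCF2001, proof of Thm. 3.1 step 2] -/
theorem gradNorm_le_gradNorm_mul_sqrt_det {x : X}
    (hle : ∀ v : TangentSpace (𝓡 3) x, h.inner x v v ≤ h'.inner x v v) (u : X → ℝ) :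
    gradNorm h u x ≤ gradNorm h' u x * Real.sqrt (LinearMap.det
      (((ofRiemannian h).sharp x).toLinearMap ∘ₗ (ofRiemannian h').toBilinForm x)) := by
  letI : RiemannianBundle (fun x : X ↦ TangentSpace (𝓡 3) x) :=
    ⟨h.toContinuousRiemannianMetric.toRiemannianMetric⟩
  haveI : FiniteDimensional ℝ (TangentSpace (𝓡 3) x) := inferInstanceAs (FiniteDimensional ℝ E3)
  set T : TangentSpace (𝓡 3) x →ₗ[ℝ] TangentSpace (𝓡 3) x :=
    ((ofRiemannian h).sharp x).toLinearMap ∘ₗ (ofRiemannian h').toBilinForm x with hT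
  have hTval : ∀ v w, ⟪T v, w⟫_ℝ = h'.inner x v w := by
    intro v w
    change h.inner x (T v) w = h'.inner x v w
    rw [← val_ofRiemannian h, hT, LinearMap.coe_comp, LinearEquiv.coe_coe, Function.comp_apply,
      val_sharp_apply, toBilinForm_apply, val_ofRiemannian]
  have hTsymm : T.IsSymmetric := fun v w ↦ by
    rw [hTval, real_inner_comm (T w) v, hTval]
    exact h'.symm x v w
  have hge : ∀ v, ⟪v, v⟫_ℝ ≤ ⟪T v, v⟫_ℝ := fun v ↦ by
    rw [hTval]
    exact hle v
  set α : Module.Dual ℝ (TangentSpace (𝓡 3) x) := (mfderiv (𝓡 3) 𝓘(ℝ, ℝ) u x).toLinearMap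
  set c : TangentSpace (𝓡 3) x := (ofRiemannian h').sharp x α with hc
  have hTc : T c = (ofRiemannian h).sharp x α := by
    rw [hT, LinearMap.coe_comp, LinearEquiv.coe_coe, Function.comp_apply, hc]
    congr 1
    exact (ofRiemannian h').flat_sharp x α
  have h1 : gradNorm h' u x ^ 2 = ⟪T c, c⟫_ℝ := by
    rw [gradNorm, Real.sq_sqrt (innerDual_self_nonneg h' x _), hTc]
    change α c = h.inner x ((ofRiemannian h).sharp x α) c
    rw [← val_ofRiemannian h, val_sharp_apply]
  have h2 : gradNorm h u x ^ 2 = ⟪T c, T c⟫_ℝ := by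
    rw [gradNorm, Real.sq_sqrt (innerDual_self_nonneg h x _), hTc]
    change α ((ofRiemannian h).sharp x α) =
      h.inner x ((ofRiemannian h).sharp x α) ((ofRiemannian h).sharp x α)
    rw [← val_ofRiemannian h, val_sharp_apply]
  have key := inner_mul_det_ge_inner_self hTsymm hge c
  rw [← h1, ← h2] at key
  have hdet : 0 ≤ LinearMap.det T := (det_endo_pos h' h x).le
  calc gradNorm h u x = Real.sqrt (gradNorm h u x ^ 2) := (Real.sqrt_sq (gradNorm_nonneg h u x)).symm
    _ ≤ Real.sqrt (gradNorm h' u x ^ 2 * LinearMap.det T) := Real.sqrt_le_sqrt key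
    _ = gradNorm h' u x * Real.sqrt (LinearMap.det T) := by
        rw [Real.sqrt_mul (sq_nonneg _), Real.sqrt_sq (gradNorm_nonneg h' u x)]

/-- The slope vanishes for one metric iff it vanishes for another (both iff `du = 0`).
[folklore] -/
theorem gradNorm_eq_zero_iff_of_metric (u : X → ℝ) (x : X) :
    gradNorm h u x = 0 ↔ gradNorm h' u x = 0 := by
  rw [gradNorm_eq_zero_iff h, gradNorm_eq_zero_iff h']

end Pointwise

/-! ### Agreement of the Riemannian measures -/

section MeasureAgree

variable (h h' : ContMDiffRiemannianMetric (𝓡 3) ∞ E3 (TangentSpace (𝓡 3) : X → Type _))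
  [T2Space X] [LocallyCompactSpace X] [MeasurableSpace X] [BorelSpace X]
  [SecondCountableTopology X]

/-- **Riemannian measures of metrics agreeing on a measurable set agree there**: if `h = h'` on
`Ω` then `μ_h|_Ω = μ_{h'}|_Ω` (the density `√det(h'⁻¹ h)` of `μ_h` with respect to `μ_{h'}`,
`riemannianMeasure_eq_withDensity_sqrt_det_endo`, equals `1` on `Ω`). Chavel 2006, §III.3.
[cite: Chavel2006, §III.3 (III.3.5)–(III.3.6)] -/
theorem riemannianMeasure_restrict_congr_of_inner_eq {Ω : Set X} (hΩm : MeasurableSet Ω)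
    (heq : ∀ x ∈ Ω, h.inner x = h'.inner x) :
    (riemannianMeasure h).restrict Ω = (riemannianMeasure h').restrict Ω := by
  rw [riemannianMeasure_eq_withDensity_sqrt_det_endo h h', restrict_withDensity hΩm]
  have hae : (fun p ↦ ENNReal.ofReal (Real.sqrt (LinearMap.det
      (((ofRiemannian h').sharp p).toLinearMap ∘ₗ (ofRiemannian h).toBilinForm p)))) =ᵐ[
      (riemannianMeasure h').restrict Ω] fun _ ↦ 1 := by
    filter_upwards [ae_restrict_mem hΩm] with p hp
    rw [sharp_comp_toBilinForm_eq_id_of_inner_eq h h' (heq p hp), LinearMap.det_id, Real.sqrt_one,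
      ENNReal.ofReal_one]
  rw [withDensity_congr_ae hae]
  exact withDensity_one

end MeasureAgree

/-! ### Local Lipschitz continuity does not depend on the metric -/

section Lipschitz

variable (h h' : ContMDiffRiemannianMetric (𝓡 3) ∞ E3 (TangentSpace (𝓡 3) : X → Type _))
  [T2Space X] [LocallyCompactSpace X]

set_option backward.isDefEq.respectTransparency false in
/-- **Local Lipschitz continuity for the Riemannian distance is independent of the Riemannian
metric.** If `w` is locally Lipschitz on `Ω` for the distance of `h`, it is so for the distance of
any other smooth Riemannian metric `h'` (with other constants): near each point both distances
are bi-Lipschitz to a chart distance after a linear change of coordinates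
(`exists_nhds_riemannianEDist_le_and_edist_le`, Burago–Burago–Ivanov 2001, §5.1), and two such
linear changes differ by a bounded invertible map. [folklore] -/
theorem IsLocLipschitzOn.of_metric {w : X → ℝ} {Ω : Set X} (hw : IsLocLipschitzOn h w Ω) :
    IsLocLipschitzOn h' w Ω := by
  -- metric-free consequence of the hypothesis: Lipschitz bounds against a linear chart image
  have key : ∀ x ∈ Ω, ∃ (K : ℝ≥0) (t : Set X), t ∈ 𝓝[Ω] x ∧ ∃ A : E3 →L[ℝ] E3,
      ∀ q ∈ t, ∀ q' ∈ t, edist (w q) (w q') ≤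
        K * edist (A (extChartAt (𝓡 3) x q)) (A (extChartAt (𝓡 3) x q')) := by
    letI : RiemannianBundle (fun x : X ↦ TangentSpace (𝓡 3) x) :=
      ⟨h.toContinuousRiemannianMetric.toRiemannianMetric⟩
    letI : PseudoEMetricSpace X := .ofRiemannianMetric (𝓡 3) X
    intro x hx
    obtain ⟨K, t, ht, hK⟩ := (show LocallyLipschitzOn Ω w from hw) hx
    obtain ⟨A, hA⟩ := exists_norm_eq_norm_symmL (I := 𝓡 3) x x
    obtain ⟨U, hU, -, hle, -⟩ :=
      exists_nhds_riemannianEDist_le_and_edist_le (I := 𝓡 3) x x (mem_chart_source E3 x) hA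
        one_lt_two
    refine ⟨K * 2, t ∩ U, inter_mem ht (mem_nhdsWithin_of_mem_nhds hU), A, fun q hq q' hq' ↦ ?_⟩
    calc edist (w q) (w q') ≤ K * edist q q' := hK hq.1 hq'.1
      _ ≤ K * ((2 : ℝ≥0) * edist (A (extChartAt (𝓡 3) x q)) (A (extChartAt (𝓡 3) x q'))) := by
          gcongr
          exact hle q hq.2 q' hq'.2
      _ = ((K * 2 : ℝ≥0) : ℝ≥0∞) * edist (A (extChartAt (𝓡 3) x q)) (A (extChartAt (𝓡 3) x q')) := by
          push_cast; ring
  -- now for the distance of `h'`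
  letI : RiemannianBundle (fun x : X ↦ TangentSpace (𝓡 3) x) :=
    ⟨h'.toContinuousRiemannianMetric.toRiemannianMetric⟩
  letI : PseudoEMetricSpace X := .ofRiemannianMetric (𝓡 3) X
  change LocallyLipschitzOn Ω w
  intro x hx
  obtain ⟨K, t, ht, A, hK⟩ := key x hx
  obtain ⟨A', hA'⟩ := exists_norm_eq_norm_symmL (I := 𝓡 3) x x
  obtain ⟨Ae, hAe⟩ :=
    exists_continuousLinearEquiv_of_norm_eq_norm_symmL (I := 𝓡 3) x x (mem_chart_source E3 x) hA'
  obtain ⟨U', hU', -, -, hge⟩ :=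
    exists_nhds_riemannianEDist_le_and_edist_le (I := 𝓡 3) x x (mem_chart_source E3 x) hA'
      one_lt_two
  set B : E3 →L[ℝ] E3 := A.comp (Ae.symm : E3 →L[ℝ] E3) with hB
  have hAB : ∀ z, A z = B (A' z) := fun z ↦ by
    rw [hB, ← hAe z]
    simp
  refine ⟨K * (‖B‖₊ * 2), t ∩ U', inter_mem ht (mem_nhdsWithin_of_mem_nhds hU'),
    fun q hq q' hq' ↦ ?_⟩
  calc edist (w q) (w q')
      ≤ K * edist (A (extChartAt (𝓡 3) x q)) (A (extChartAt (𝓡 3) x q')) := hK q hq.1 q' hq'.1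
    _ = K * edist (B (A' (extChartAt (𝓡 3) x q))) (B (A' (extChartAt (𝓡 3) x q'))) := by
        rw [hAB, hAB]
    _ ≤ K * (‖B‖₊ * edist (A' (extChartAt (𝓡 3) x q)) (A' (extChartAt (𝓡 3) x q'))) := by
        gcongr
        exact B.lipschitz.edist_le_mul _ _
    _ ≤ K * (‖B‖₊ * ((2 : ℝ≥0) * edist q q')) := by
        gcongr
        exact hge q hq.2 q' hq'.2
    _ = ((K * (‖B‖₊ * 2) : ℝ≥0) : ℝ≥0∞) * edist q q' := by push_cast; ring

/-- Local Lipschitz continuity (Riemannian distance) is the same notion for all smooth Riemannian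
metrics on `X`. [folklore] -/
theorem isLocLipschitzOn_iff_of_metric {w : X → ℝ} {Ω : Set X} :
    IsLocLipschitzOn h w Ω ↔ IsLocLipschitzOn h' w Ω :=
  ⟨fun hw ↦ hw.of_metric h h', fun hw ↦ hw.of_metric h' h⟩

/-- Competitors in (1.5) (`{v ≠ u} ⊂⊂ Ω`, `v` locally Lipschitz on `Ω`) are the same for all
metrics. [folklore] -/
theorem IsCompetitor.of_metric {u v : X → ℝ} {Ω : Set X} (hv : IsCompetitor h u Ω v) :
    IsCompetitor h' u Ω v :=
  ⟨hv.1.of_metric h h', hv.2⟩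

end Lipschitz

/-! ### The weak formulation for two metrics agreeing on `Ω` -/

section Weak

variable (h h' : ContMDiffRiemannianMetric (𝓡 3) ∞ E3 (TangentSpace (𝓡 3) : X → Type _))
  [T2Space X] [LocallyCompactSpace X] [MeasurableSpace X] [BorelSpace X]
  [SecondCountableTopology X]

/-- **`J_u^K(v)` only depends on the metric on `Ω ⊇ K`**: if `h = h'` on the measurable set `Ω`
and `K ⊆ Ω` is measurable, the energies computed with `h` and `h'` coincide (same slopes on `Ω`,
same Riemannian measure on `Ω`). [cite: HuiskenIlmanenIMCF2001, proof of Thm. 3.1 step 2 ("g_L = g on F_L")] -/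
theorem imcfEnergy_congr_of_inner_eq {Ω K : Set X} (heq : ∀ x ∈ Ω, h.inner x = h'.inner x)
    (hΩm : MeasurableSet Ω) (hKm : MeasurableSet K) (hKΩ : K ⊆ Ω) (u v : X → ℝ) :
    imcfEnergy h u K v = imcfEnergy h' u K v := by
  unfold imcfEnergy
  have hμ : (riemannianMeasure h).restrict K = (riemannianMeasure h').restrict K := by
    rw [← restrict_restrict_of_subset hKΩ,
      riemannianMeasure_restrict_congr_of_inner_eq h h' hΩm heq, restrict_restrict_of_subset hKΩ]
  rw [hμ]
  refine setIntegral_congr_fun hKm fun x hx ↦ ?_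
  rw [gradNorm_congr_of_inner_eq h h' (heq x (hKΩ hx)),
    gradNorm_congr_of_inner_eq h h' (heq x (hKΩ hx))]

/-- **Weak solutions of (∗∗) on `Ω` only depend on the metric on `Ω`.** If `h = h'` on the open
set `Ω`, every weak solution of (1.5) on `Ω` for `h` is one for `h'`. This is the tacit step of
the proof of Thm. 3.1, step 2, where the solution `u_L` for the modified metric `g_L` is used as a
solution for `g` on `F_L` ("`g_L = g` on `F_L` … the Compactness Theorem 2.1 yields a solution `u`
defined everywhere"). [cite: HuiskenIlmanenIMCF2001, proof of Thm. 3.1 step 2] -/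
theorem IsWeakSolution.of_metric {u : X → ℝ} {Ω : Set X} (hΩ : IsOpen Ω)
    (heq : ∀ x ∈ Ω, h.inner x = h'.inner x) (hu : IsWeakSolution h u Ω) :
    IsWeakSolution h' u Ω := by
  refine ⟨hu.1.of_metric h h', fun v hv K hK hKΩ hvK ↦ ?_⟩
  have key := hu.2 v (hv.of_metric h' h) K hK hKΩ hvK
  rwa [imcfEnergy_congr_of_inner_eq h h' heq hΩ.measurableSet hK.measurableSet hKΩ,
    imcfEnergy_congr_of_inner_eq h h' heq hΩ.measurableSet hK.measurableSet hKΩ] at key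

/-- **Weak subsolutions on `Ω` only depend on the metric on `Ω`** (the step "`min(v, L)` is a weak
subsolution in `U_L` with respect to `g` … with respect to `g_L`" of the proof of Thm. 3.1, step 2,
on the part `{v < L}` where `g_L = g`). [cite: HuiskenIlmanenIMCF2001, proof of Thm. 3.1 step 2] -/
theorem IsWeakSubsolution.of_metric {u : X → ℝ} {Ω : Set X} (hΩ : IsOpen Ω)
    (heq : ∀ x ∈ Ω, h.inner x = h'.inner x) (hu : IsWeakSubsolution h u Ω) :
    IsWeakSubsolution h' u Ω := by
  refine ⟨hu.1.of_metric h h', fun v hv hle K hK hKΩ hvK ↦ ?_⟩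
  have key := hu.2 v (hv.of_metric h' h) hle K hK hKΩ hvK
  rwa [imcfEnergy_congr_of_inner_eq h h' heq hΩ.measurableSet hK.measurableSet hKΩ,
    imcfEnergy_congr_of_inner_eq h h' heq hΩ.measurableSet hK.measurableSet hKΩ] at key

/-- **Weak supersolutions on `Ω` only depend on the metric on `Ω`.**
[cite: HuiskenIlmanenIMCF2001, proof of Thm. 3.1 step 2] -/
theorem IsWeakSupersolution.of_metric {u : X → ℝ} {Ω : Set X} (hΩ : IsOpen Ω)
    (heq : ∀ x ∈ Ω, h.inner x = h'.inner x) (hu : IsWeakSupersolution h u Ω) :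
    IsWeakSupersolution h' u Ω := by
  refine ⟨hu.1.of_metric h h', fun v hv hle K hK hKΩ hvK ↦ ?_⟩
  have key := hu.2 v (hv.of_metric h' h) hle K hK hKΩ hvK
  rwa [imcfEnergy_congr_of_inner_eq h h' heq hΩ.measurableSet hK.measurableSet hKΩ,
    imcfEnergy_congr_of_inner_eq h h' heq hΩ.measurableSet hK.measurableSet hKΩ] at key

/-- Weak solutions of (1.5) on an open `Ω` are the same for two metrics agreeing on `Ω`.
[cite: HuiskenIlmanenIMCF2001, proof of Thm. 3.1 step 2] -/
theorem isWeakSolution_iff_of_inner_eq {u : X → ℝ} {Ω : Set X} (hΩ : IsOpen Ω)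
    (heq : ∀ x ∈ Ω, h.inner x = h'.inner x) :
    IsWeakSolution h u Ω ↔ IsWeakSolution h' u Ω :=
  ⟨fun hu ↦ hu.of_metric h h' hΩ heq, fun hu ↦ hu.of_metric h' h hΩ fun x hx ↦ (heq x hx).symm⟩

/-- Weak subsolutions of (1.5) on an open `Ω` are the same for two metrics agreeing on `Ω`.
[cite: HuiskenIlmanenIMCF2001, proof of Thm. 3.1 step 2] -/
theorem isWeakSubsolution_iff_of_inner_eq {u : X → ℝ} {Ω : Set X} (hΩ : IsOpen Ω)
    (heq : ∀ x ∈ Ω, h.inner x = h'.inner x) :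
    IsWeakSubsolution h u Ω ↔ IsWeakSubsolution h' u Ω :=
  ⟨fun hu ↦ hu.of_metric h h' hΩ heq, fun hu ↦ hu.of_metric h' h hΩ fun x hx ↦ (heq x hx).symm⟩

/-- Weak supersolutions of (1.5) on an open `Ω` are the same for two metrics agreeing on `Ω`.
[cite: HuiskenIlmanenIMCF2001, proof of Thm. 3.1 step 2] -/
theorem isWeakSupersolution_iff_of_inner_eq {u : X → ℝ} {Ω : Set X} (hΩ : IsOpen Ω)
    (heq : ∀ x ∈ Ω, h.inner x = h'.inner x) :
    IsWeakSupersolution h u Ω ↔ IsWeakSupersolution h' u Ω :=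
  ⟨fun hu ↦ hu.of_metric h h' hΩ heq, fun hu ↦ hu.of_metric h' h hΩ fun x hx ↦ (heq x hx).symm⟩

end Weak

/-! ### Enlarging the metric off `{|∇u| ≠ 0}` preserves weak subsolutions -/

section Monotone

variable (h h' : ContMDiffRiemannianMetric (𝓡 3) ∞ E3 (TangentSpace (𝓡 3) : X → Type _))
  [T2Space X] [LocallyCompactSpace X] [MeasurableSpace X] [BorelSpace X]
  [SecondCountableTopology X]

/-- **Enlarging the metric off `{|∇u| ≠ 0}` preserves weak subsolutions** (Huisken–Ilmanen 2001,
proof of Thm. 3.1, step 2: "Since `g = g_L` where `v < L` and otherwise `g_L ≥ g`, it follows that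
`min(v, L)` remains a weak subsolution when considered with respect to the metric `g_L`"). Let
`h ≤ h'` on `X`, `h = h'` on the open set `W`, let `u` be a weak subsolution of (∗∗) on the open
set `Ω` for `h` with `|∇u|_h = 0` `μ_h`-a.e. on `Ω ∖ W`. Then `u` is a weak subsolution of (∗∗)
on `Ω` for `h'`. With `dμ_{h'} = ρ dμ_h`, `ρ = √det(♯_h ∘ ♭_{h'}) ≥ 1`: `ρ|∇u|_{h'} = |∇u|_h` a.e.
on `Ω` (`ρ = 1`, `|∇u|_{h'} = |∇u|_h` on `W`; both slopes vanish a.e. off `W`) and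
`ρ|∇w|_{h'} ≥ |∇w|_h` (`gradNorm_le_gradNorm_mul_sqrt_det`) for the competitor `w ≤ u`, whence
`J^{h'}_u(w) − J^{h'}_u(u) ≥ J^h_u(w) − J^h_u(u) ≥ 0`.
[cite: HuiskenIlmanenIMCF2001, proof of Thm. 3.1 step 2] -/
theorem IsWeakSubsolution.of_metric_le {u : X → ℝ} {Ω W : Set X} (hΩ : IsOpen Ω) (hW : IsOpen W)
    (hle : ∀ (x : X) (v : TangentSpace (𝓡 3) x), h.inner x v v ≤ h'.inner x v v)
    (heq : ∀ x ∈ W, h.inner x = h'.inner x)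
    (hu : IsWeakSubsolution h u Ω)
    (hzero : ∀ᵐ x ∂(riemannianMeasure h).restrict (Ω \ W), gradNorm h u x = 0) :
    IsWeakSubsolution h' u Ω := by
  have hul : IsLocLipschitzOn h u Ω := hu.1
  refine ⟨hul.of_metric h h', fun w hw hwle K hK hKΩ hwK ↦ ?_⟩
  have hw' : IsCompetitor h u Ω w := ⟨hw.1.of_metric h' h, hw.2⟩
  have hwl : IsLocLipschitzOn h w Ω := hw'.1
  have hwl' : IsLocLipschitzOn h' w Ω := hw.1
  have key := hu.2 w hw' hwle K hK hKΩ hwK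
  -- the density `ρ = √det T` of `μ_{h'}` w.r.t. `μ_h`
  set ρ : X → ℝ := fun p ↦ Real.sqrt (LinearMap.det
    (((ofRiemannian h).sharp p).toLinearMap ∘ₗ (ofRiemannian h').toBilinForm p)) with hρ
  have hρc : Continuous ρ := continuous_sqrt_det_endo h' h
  have hρ0 : ∀ p, 0 ≤ ρ p := fun p ↦ Real.sqrt_nonneg _
  have hμ' : riemannianMeasure h' = (riemannianMeasure h).withDensity fun p ↦ ENNReal.ofReal (ρ p) :=
    riemannianMeasure_eq_withDensity_sqrt_det_endo h' h
  -- integrals for `h'` as weighted integrals for `h`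
  have hρm : Measurable fun p ↦ ENNReal.ofReal (ρ p) :=
    ENNReal.measurable_ofReal.comp hρc.measurable
  have hwd : ∀ f : X → ℝ,
      ∫ x in K, f x ∂riemannianMeasure h' = ∫ x in K, ρ x * f x ∂riemannianMeasure h := by
    intro f
    rw [hμ', restrict_withDensity hK.measurableSet,
      integral_withDensity_eq_integral_toReal_smul₀ hρm.aemeasurable (Eventually.of_forall fun _ ↦
        ENNReal.ofReal_lt_top)]
    refine integral_congr_ae (Eventually.of_forall fun x ↦ ?_)
    simp only [ENNReal.toReal_ofReal (hρ0 x), smul_eq_mul]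
  -- bounds and integrability on `K`
  haveI : IsFiniteMeasureOnCompacts (riemannianMeasure h) :=
    ⟨fun K hK ↦ riemannianVolume_lt_top_of_isCompact_holds h le_rfl hK⟩
  have hIw : IntegrableOn (gradNorm h w) K (riemannianMeasure h) :=
    hwl.integrableOn_gradNorm h hΩ hK hKΩ
  have hIwu : IntegrableOn (fun x ↦ w x * gradNorm h u x) K (riemannianMeasure h) :=
    hul.integrableOn_mul_gradNorm h hΩ hK hKΩ ((hwl.continuousOn h).mono hKΩ)
  -- `ρ |∇u|_{h'} = |∇u|_h` a.e. on `K`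
  have hae_u : ∀ᵐ x ∂(riemannianMeasure h).restrict K, ρ x * gradNorm h' u x = gradNorm h u x := by
    have h1 : ∀ᵐ x ∂(riemannianMeasure h).restrict K, x ∈ Ω \ W → gradNorm h u x = 0 := by
      have := (ae_restrict_iff' (hΩ.measurableSet.diff hW.measurableSet)).1 hzero
      exact ae_restrict_of_ae this
    filter_upwards [ae_restrict_mem hK.measurableSet, h1] with x hxK hx
    by_cases hxW : x ∈ W
    · rw [hρ]
      simp only
      rw [sharp_comp_toBilinForm_eq_id_of_inner_eq h' h (heq x hxW).symm, LinearMap.det_id,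
        Real.sqrt_one, one_mul, gradNorm_congr_of_inner_eq h h' (heq x hxW)]
    · have h0 : gradNorm h u x = 0 := hx ⟨hKΩ hxK, hxW⟩
      rw [h0, (gradNorm_eq_zero_iff_of_metric h h' u x).1 h0, mul_zero]
  -- `ρ |∇w|_{h'} ≥ |∇w|_h` everywhere
  have hge_w : ∀ x, gradNorm h w x ≤ ρ x * gradNorm h' w x := fun x ↦ by
    rw [mul_comm]; exact gradNorm_le_gradNorm_mul_sqrt_det h h' (hle x) w
  -- rewrite the `h'`-energies as `h`-integrals
  have hL : imcfEnergy h' u K u = ∫ x in K, (gradNorm h u x + u x * gradNorm h u x)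
      ∂riemannianMeasure h := by
    rw [imcfEnergy, hwd]
    refine integral_congr_ae ?_
    filter_upwards [hae_u] with x hx
    rw [mul_add, mul_left_comm, hx]
  have hR : imcfEnergy h' u K w = ∫ x in K, (ρ x * gradNorm h' w x + w x * gradNorm h u x)
      ∂riemannianMeasure h := by
    rw [imcfEnergy, hwd]
    refine integral_congr_ae ?_
    filter_upwards [hae_u] with x hx
    rw [mul_add, mul_left_comm (ρ x) (w x), hx]
  rw [hL, hR]
  -- integrability of `ρ |∇w|_{h'}` on `K` for `μ_h` (bounded and measurable)
  obtain ⟨Cw, hCw⟩ := hwl'.exists_forall_gradNorm_le h' hΩ hK hKΩ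
  obtain ⟨Bρ, hBρ⟩ := hK.exists_bound_of_continuousOn hρc.continuousOn
  have hac : riemannianMeasure h ≪ riemannianMeasure h' := by
    rw [riemannianMeasure_eq_withDensity_sqrt_det_endo h h']
    exact withDensity_absolutelyContinuous _ _
  have hIρw : IntegrableOn (fun x ↦ ρ x * gradNorm h' w x) K (riemannianMeasure h) := by
    refine Measure.integrableOn_of_bounded hK.measure_lt_top.ne
      ((hρc.aestronglyMeasurable).mul ((aestronglyMeasurable_gradNorm h' w).mono_ac hac))
      (M := Bρ * Cw) ?_
    · filter_upwards [ae_restrict_mem hK.measurableSet] with x hx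
      rw [norm_mul, Real.norm_of_nonneg (gradNorm_nonneg h' w x)]
      exact mul_le_mul (hBρ x hx) (hCw x hx) (gradNorm_nonneg h' w x)
        ((norm_nonneg _).trans (hBρ x hx))
  -- compare
  have key' : ∫ x in K, (gradNorm h u x + u x * gradNorm h u x) ∂riemannianMeasure h ≤
      ∫ x in K, (gradNorm h w x + w x * gradNorm h u x) ∂riemannianMeasure h := key
  refine key'.trans (setIntegral_mono_on (hIw.add hIwu) (hIρw.add hIwu) hK.measurableSet ?_)
  intro x _
  linarith [hge_w x]

/-- **"`min(v, L)` remains a weak subsolution with respect to `g_L`"** (Huisken–Ilmanen 2001,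
proof of Thm. 3.1, step 2, verbatim): if `v` is a weak subsolution of (∗∗) on the open set `Ω`
for `h`, `h ≤ h'` on `X` and `h = h'` wherever `v < L`, then `min(v, L)` is a weak subsolution on
`Ω` for `h'` — by (1.18) (`IsWeakSubsolution.inf_const`) for `h`, and
`IsWeakSubsolution.of_metric_le` with `W = Ω ∩ {v < L}`, off which `min(v, L) = L` has vanishing
slope a.e. (`IsLocLipschitzOn.ae_gradNorm_eq_zero_of_eq_const`).
[cite: HuiskenIlmanenIMCF2001, proof of Thm. 3.1 step 2] -/
theorem IsWeakSubsolution.inf_const_of_metric_le {v : X → ℝ} {Ω : Set X} (hΩ : IsOpen Ω)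
    (hv : IsWeakSubsolution h v Ω) (L : ℝ)
    (hle : ∀ (x : X) (w : TangentSpace (𝓡 3) x), h.inner x w w ≤ h'.inner x w w)
    (heq : ∀ x, v x < L → h.inner x = h'.inner x) :
    IsWeakSubsolution h' (fun x ↦ min (v x) L) Ω := by
  have hsub : IsWeakSubsolution h (fun x ↦ min (v x) L) Ω := hv.inf_const h hΩ L
  have hWo : IsOpen (Ω ∩ v ⁻¹' Iio L) := (hv.1.continuousOn h).isOpen_inter_preimage hΩ isOpen_Iio
  refine hsub.of_metric_le h h' hΩ hWo hle (fun x hx ↦ heq x hx.2) ?_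
  refine (ae_restrict_iff' (hΩ.measurableSet.diff hWo.measurableSet)).2 ?_
  filter_upwards [hsub.1.ae_gradNorm_eq_zero_of_eq_const h hΩ L] with p hp hpmem
  refine hp hpmem.1 (min_eq_right (not_lt.1 fun hlt ↦ hpmem.2 ⟨hpmem.1, hlt⟩))

/-- The same for subsolutions of the initial value problem (††): if `v` is a weak subsolution of
(††) with initial condition `F₀` for `h`, `h ≤ h'`, and `h = h'` on `{v < L}`, then `min(v, L)` is
a weak subsolution of (∗∗) on `X ∖ F̄₀` for `h'` — the comparison function of the proof of
Thm. 3.1, step 2, for the modified metric `g_L`. [cite: HuiskenIlmanenIMCF2001, proof of Thm. 3.1 step 2] -/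
theorem IsWeakSubsolutionIVP.inf_const_of_metric_le {v : X → ℝ} {F₀ : Set X}
    (hv : IsWeakSubsolutionIVP h v F₀) (L : ℝ)
    (hle : ∀ (x : X) (w : TangentSpace (𝓡 3) x), h.inner x w w ≤ h'.inner x w w)
    (heq : ∀ x, v x < L → h.inner x = h'.inner x) :
    IsWeakSubsolution h' (fun x ↦ min (v x) L) (closure F₀)ᶜ :=
  hv.2.2.inf_const_of_metric_le h h' isClosed_closure.isOpen_compl L hle heq

end Monotone

end Literature.Geometry.Lorentzian

end
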